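import Summits.HodgeConjecture.HodgeConjecture.Theorems.F0P3cStCharTSSaHeadTorus6      -- ★ p850576 (this seat): head ₆ (density `Δ ∘ ι`); brings ★ ₄ (p850157), ★ p849458, ★ «PSM★», ★ WeylCoreDensity, ★ ShellsTTLevels, ★ ShellWeight
import Literature.NumberTheory.Rogawski1990.Ch12Sec5Inputs                                 -- ★ (M1) `EllipticData.CharRegularity` (the package's own Harish-Chandra socket)
import HarnessLib

/-!
# F0 · P3c · line LH6 «StCharTS» — «Sa-HEAD★» EDITION «(CHAR-G) OUT»: organ (S-a) with the Harish-Chandra socket read from the package's OWN (M1) `𝔇.CharRegularity`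
# plus the single print clause (CHAR-CL) «`χ_π` is a class function on `G^{reg}`» [Rogawski1990 §1.6 pp. 5–6; L. 12.7.2 (proof) p. 193]

Cell `pub/hodgecm-mathlib`, crux H413 = `stmt-HodgeConjecture-24833` (`--supports` lane, helper), route HCCMUnconditional; seat LH6-p01 (g3), integrator of the (TOR) road
(desk F0P3-plan (g15) deal 08:50:21Z «CLASS-FN★ + ED. 10», shape (α) of the integrator's 09:00Z guard).  THEOREMS ONLY, sorry-free, ★-only imports.
THE STATEMENT `stSupportFiniteSqInt_of_carpet_torus₇` = ★ p850576 `stSupportFiniteSqInt_of_carpet_torus₆` with its hypothesis (CHAR-G) «∀ π, Measurable (χ_π) ∧ LocallyIntegrable ∧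
IsClassFunOn regG ∧ represents the trace» (ED. 7) REPLACED by the two binders `𝔇.CharRegularity →` (= the package's own (M1) socket ★ `Ch12Sec5Inputs` :119, stated for
square-integrable `π`: measurable, locally integrable, locally constant on `regG`, represents the trace) and **(CHAR-CL) «∀ π, 𝔇.IsL2 π → IsClassFunOn 𝔇.regG (𝔇.char π)»**;
all other texts VERBATIM ((TOR⁗) at `Δ ∘ ι`, COMPAT, carpets, sockets).  Net for the leaf's (S-𝔇): the (CHAR-G) conjunct (4 clauses, all `π`) shrinks to (CHAR-CL) (1 clause,
L² `π`) — (M1) is already among its 19 sockets.  WHY (CHAR-CL) STAYS A SOCKET: in ★ `SmoothCharacter` the conjugation invariance of `IrrClass.smoothTrace` is level-independent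
only for ADMISSIBLE representatives (★ `smoothTrace_comp_continuousMulEquiv (hadm)`), and `IrrClass.IsSquareIntegrable` carries no admissibility; so «(M1) ⇒ class function»
is not derivable in the organ's frame (it would be with an admissibility socket — shape (β), not taken).
PROOF.  ★ p849458 (∃-form (TOR)) at `Ftr := torusTransform`, `Ω := Ω°_w` (`w` from `PlacesOver L v ≠ ∅`), `toC := pairChar`: (pin) `rfl`; (WM∕L2M) with `Θ_σ := Δ∘ι·χ_σ∘ι` —
`𝔇.IsL2 σ` is the organ's `σ.IsSquareIntegrable μZ` by COMPAT `hμGZ` (★ `Ch12Sec5Defs` :279), so (M1) gives measurability ∕ local integrability ∕ the trace formula and (CHAR-CL)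
the conjugation invariance on `Ω° ⊆ regG` (★ (H3′)), then (WIF°) at `Δ∘ι` := ★ `weylIntegration_core_of_shells` (★ p850378) over ★ `exists_levels_shellsTT` (LH6-p05 (g3)) with
the `M_c`-congruence of ★ ₆; (HM) likewise over (M1H) ∕ `UpSpec` ∕ (UPR); (PSM) = ★ p849653 through `Ω° ⊆ hyperbolicSet` ★ (H3); (SHF′°) = ★ `shf_core` (LH6-p05 (g3)).
HONEST LABEL: HC_CM is proved only modulo the 7 printed citations (2 remaining: hLiu418 = stmt-HodgeConjecture-24832, h413 = stmt-HodgeConjecture-24833) until rung 0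
closes; count-neutral narrowing ((CHAR-G) 4 clauses ↦ (CHAR-CL) 1 clause); the torus block of (S-𝔇) is then (CHAR-CL) + Casselman's (L1M)(L1M-up) at `D_G = |D|^{1∕2}`.

## References
* [Rogawski1990] J. D. Rogawski, *Automorphic Representations of Unitary Groups in Three Variables*, Ann. of Math. Stud. 123 (1990): §1.6 pp. 5–6; §12.5 pp. 182–183;
  §12.7 L. 12.7.1 (proof) p. 191, L. 12.7.2 (proof) p. 193.
* [vanDijk1972] G. van Dijk, *Computation of certain induced characters of p-adic groups*, Math. Ann. 199 (1972), §2, Thm. p. 237.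
* [HarishChandra1970] Harish-Chandra, *Harmonic analysis on reductive p-adic groups*, LNM 162 (1970), Lemma 42.
-/

set_option autoImplicit false
-- the mandated namespace has the single-problem summit's repeated segment (`HodgeConjecture.HodgeConjecture`)
set_option linter.dupNamespace false

noncomputable section

open NumberField IsDedekindDomain MeasureTheory MeasureTheory.Measure Filter Topology
open scoped Matrix MatrixGroups BigOperators Pointwise NNReal
open Literature.NumberTheory.Rogawski1990 Literature.NumberTheory.Automorphic Literature.NumberTheory.Automorphic.UnitaryGroup
open Literature.NumberTheory.GaloisRepresentations
open Literature.MeasureTheory.Group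

namespace Summit.HodgeConjecture.HodgeConjecture.Cruxes.H413.F0P3cStCharTSSaHeadTorus7

open Literature.NumberTheory.Rogawski1990.Ch12Sec5
open Summit.HodgeConjecture.HodgeConjecture.Cruxes.H413.F0P3cStCharTSTorusDefs
open Summit.HodgeConjecture.HodgeConjecture.Cruxes.H413.F0P3cStCharTSTorusCompactPart
open Summit.HodgeConjecture.HodgeConjecture.Cruxes.H413.F0P3cStCharTSHyperbolicSet
open Summit.HodgeConjecture.HodgeConjecture.Cruxes.H413.F0P3cStCharTSHyperbolicCore
open Summit.HodgeConjecture.HodgeConjecture.Cruxes.H413.F0P3cStCharTSPsmTransport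
open Summit.HodgeConjecture.HodgeConjecture.Cruxes.H413

set_option maxHeartbeats 1600000 in
-- the statement alone (≈ 240 lines of binders) exceeds the default budget
/-- **«Sa-HEAD★» EDITION «(CHAR-G) OUT»** — organ (S-a) from the §12.5–12.6 datum (COMPAT 7), the TR carpets, the datum-level sockets incl. the package's own (M1) `CharRegularity`
and the one-clause (CHAR-CL), (SPLIT-NOT-ELL), and (TOR⁗) = Casselman's (L1M)(L1M-up) at `D_G = |D_G|^{1∕2} = Δ ∘ ι`. [cite: Rogawski1990, §12.7 Lemma 12.7.2 (proof) p. 193;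
§12.5 pp. 182–183; §1.6 pp. 5–6] [cite: Rogawski1990, §12.7 L. 12.7.1 (proof) p. 191] [cite: vanDijk1972, §2] -/
theorem stSupportFiniteSqInt_of_carpet_torus₇ :
  ∀ (L : Type) [Field L] [NumberField L] [IsCMField L] (μ : HeckeCharacter L) (ξ : OneDimAutRepH L) (v : HeightOneSpectrum (𝓞 ↥(maximalRealSubfield L))),
    (∀ w : PlacesOver L v, IsCMField.complexConj L • w.1 = w.1) → μ.IsUnitary →
    (∀ x : Literature.NumberTheory.GaloisRepresentations.ideleGroup ↥(maximalRealSubfield L),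
      μ (AdeleRing.ideleBaseChange (↥(maximalRealSubfield L)) L x) = quadraticHeckeCharCM L x) →
    ∀ [MeasurableSpace ((UnitaryGroup.cmDatum L 2 (Matrix.of fun i j : Fin 2 => if i.val + j.val + 1 = 2 then (1 : L) else 0)).Local v × (UnitaryGroup.cmDatum L 1 (Matrix.of fun i j : Fin 1 => if i.val + j.val + 1 = 1 then (1 : L) else 0)).Local v)] [BorelSpace ((UnitaryGroup.cmDatum L 2 (Matrix.of fun i j : Fin 2 => if i.val + j.val + 1 = 2 then (1 : L) else 0)).Local v × (UnitaryGroup.cmDatum L 1 (Matrix.of fun i j : Fin 1 => if i.val + j.val + 1 = 1 then (1 : L) else 0)).Local v)] [MeasurableSpace (Gqs L v)] [BorelSpace (Gqs L v)]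
      (νHv : Measure ((UnitaryGroup.cmDatum L 2 (Matrix.of fun i j : Fin 2 => if i.val + j.val + 1 = 2 then (1 : L) else 0)).Local v × (UnitaryGroup.cmDatum L 1 (Matrix.of fun i j : Fin 1 => if i.val + j.val + 1 = 1 then (1 : L) else 0)).Local v)) (νQv : Measure (Gqs L v))
      [νHv.IsHaarMeasure] [νHv.IsMulRightInvariant] [νQv.IsHaarMeasure] [νQv.IsMulRightInvariant],
    letI : ∀ a : ((UnitaryGroup.cmDatum L 2 (Matrix.of fun i j : Fin 2 => if i.val + j.val + 1 = 2 then (1 : L) else 0)).Local v × (UnitaryGroup.cmDatum L 1 (Matrix.of fun i j : Fin 1 => if i.val + j.val + 1 = 1 then (1 : L) else 0)).Local v), MeasurableSpace (((UnitaryGroup.cmDatum L 2 (Matrix.of fun i j : Fin 2 => if i.val + j.val + 1 = 2 then (1 : L) else 0)).Local v × (UnitaryGroup.cmDatum L 1 (Matrix.of fun i j : Fin 1 => if i.val + j.val + 1 = 1 then (1 : L) else 0)).Local v) ⧸ Subgroup.centralizer ({a} : Set ((UnitaryGroup.cmDatum L 2 (Matrix.of fun i j : Fin 2 => if i.val + j.val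 + 1 = 2 then (1 : L) else 0)).Local v × (UnitaryGroup.cmDatum L 1 (Matrix.of fun i j : Fin 1 => if i.val + j.val + 1 = 1 then (1 : L) else 0)).Local v))) := fun _ => borel _
    haveI : ∀ a : ((UnitaryGroup.cmDatum L 2 (Matrix.of fun i j : Fin 2 => if i.val + j.val + 1 = 2 then (1 : L) else 0)).Local v × (UnitaryGroup.cmDatum L 1 (Matrix.of fun i j : Fin 1 => if i.val + j.val + 1 = 1 then (1 : L) else 0)).Local v), BorelSpace (((UnitaryGroup.cmDatum L 2 (Matrix.of fun i j : Fin 2 => if i.val + j.val + 1 = 2 then (1 : L) else 0)).Local v × (UnitaryGroup.cmDatum L 1 (Matrix.of fun i j : Fin 1 => if i.val + j.val + 1 = 1 then (1 : L) else 0)).Local v) ⧸ Subgroup.centralizer ({a} : Set ((UnitaryGroup.cmDatum L 2 (Matrix.of fun i j : Fin 2 => if i.val + j.val + 1 = 2 then (1 : L) else 0)).Local v × (UnitaryGroup.cmDatum L 1 (Matrix.of fun i j : Fin 1 => if i.val + j.val + 1 = 1 then (1 : L) else 0)).Local v))) := fun _ => ⟨rfl⟩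
    letI : ∀ γ : Gqs L v, MeasurableSpace (Gqs L v ⧸ Subgroup.centralizer ({γ} : Set (Gqs L v))) := fun _ => borel _
    haveI : ∀ γ : Gqs L v, BorelSpace (Gqs L v ⧸ Subgroup.centralizer ({γ} : Set (Gqs L v))) := fun _ => ⟨rfl⟩
    ∀ (mHv : OrbitalMeasureFamily ((UnitaryGroup.cmDatum L 2 (Matrix.of fun i j : Fin 2 => if i.val + j.val + 1 = 2 then (1 : L) else 0)).Local v × (UnitaryGroup.cmDatum L 1 (Matrix.of fun i j : Fin 1 => if i.val + j.val + 1 = 1 then (1 : L) else 0)).Local v)) (mQv : OrbitalMeasureFamily (Gqs L v)),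
      mHv.IsCanonical (IsLocalGRegular L v) νHv →
      mQv.IsCanonical (fun γ => IsRegularElt (γ.val : GL (Fin 3) (UnitaryGroup.LocalRing L v))) νQv →
      IsLocalDeltaTransferExists L (qsForm L) v ((finExplicitCollection L (qsForm L) μ (finExplicitDelta_conj_left_all L (qsForm L) μ) (finExplicitDelta_conj_right_all L (qsForm L) μ)) v) mHv mQv IsLocSmooth IsLocSmooth →
      ∀ (π₁ πSt : IrrClass ((UnitaryGroup.cmDatum L 2 (Matrix.of fun i j : Fin 2 => if i.val + j.val + 1 = 2 then (1 : L) else 0)).Local v × (UnitaryGroup.cmDatum L 1 (Matrix.of fun i j : Fin 1 => if i.val + j.val + 1 = 1 then (1 : L) else 0)).Local v)),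
        HLengthTwoLabels L v
          (torusCharPair (conjLocal L (IsCMField.complexConj L) v) (cmLocalForm L 2 v) (cmLocalForm_eq_over L 2 v) 0
            ((torusLocalComponent L (IsCMField.complexConj L) v ξ.η).comp
                (quotConj (conjLocal L (IsCMField.complexConj L) v) (conjLocal_conjLocal_cm L v)) *
              halfModulusChar (UnitaryGroup.LocalRing L v))
            (torusLocalComponent L (IsCMField.complexConj L) v ξ.ψ))
          ((torusLocalComponent L (IsCMField.complexConj L) v ξ.ψ).comp (localDet (IsCMField.complexConj L) v (isUnit_antidiagOne_det L 1))) π₁ πSt →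
        (∀ fH : ((UnitaryGroup.cmDatum L 2 (Matrix.of fun i j : Fin 2 => if i.val + j.val + 1 = 2 then (1 : L) else 0)).Local v × (UnitaryGroup.cmDatum L 1 (Matrix.of fun i j : Fin 1 => if i.val + j.val + 1 = 1 then (1 : L) else 0)).Local v) → ℂ, IsLocSmooth fH → π₁.smoothTrace νHv fH = charDist (ξ.xiLocalChar v) νHv fH) →
      ∀ [MeasurableSpace (Gqs L v ⧸ Subgroup.center (Gqs L v))] [BorelSpace (Gqs L v ⧸ Subgroup.center (Gqs L v))]
        (μZ : Measure (Gqs L v ⧸ Subgroup.center (Gqs L v))) [μZ.IsHaarMeasure],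
      -- ══ the §12.5–12.6 DATUM on the model (★ TR carpet, a BINDER) and its COMPATIBILITY with the organ's currency (byte-identical with ★ p848567 ∕ ★ p848673) ══
      ∀ (𝔇 : Ch12Sec5.EllipticData (Gqs L v) ((UnitaryGroup.cmDatum L 2 (Matrix.of fun i j : Fin 2 => if i.val + j.val + 1 = 2 then (1 : L) else 0)).Local v × (UnitaryGroup.cmDatum L 1 (Matrix.of fun i j : Fin 1 => if i.val + j.val + 1 = 1 then (1 : L) else 0)).Local v)),
      𝔇.μG = νQv → 𝔇.μH = νHv → 𝔇.μGZ = μZ → 𝔇.orb = mQv →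
      (∀ γ : Gqs L v, γ ∈ 𝔇.regG ↔ IsRegularElt (γ.val : GL (Fin 3) (UnitaryGroup.LocalRing L v))) →
      (∀ (φ : Gqs L v → ℂ) (fH : ((UnitaryGroup.cmDatum L 2 (Matrix.of fun i j : Fin 2 => if i.val + j.val + 1 = 2 then (1 : L) else 0)).Local v × (UnitaryGroup.cmDatum L 1 (Matrix.of fun i j : Fin 1 => if i.val + j.val + 1 = 1 then (1 : L) else 0)).Local v) → ℂ), 𝔇.IsTransfer φ fH ↔ IsLocalDeltaTransfer L (qsForm L) v ((finExplicitCollection L (qsForm L) μ (finExplicitDelta_conj_left_all L (qsForm L) μ) (finExplicitDelta_conj_right_all L (qsForm L) μ)) v) mHv mQv fH φ) →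
      ({πSt} : Finset (IrrClass ((UnitaryGroup.cmDatum L 2 (Matrix.of fun i j : Fin 2 => if i.val + j.val + 1 = 2 then (1 : L) else 0)).Local v × (UnitaryGroup.cmDatum L 1 (Matrix.of fun i j : Fin 1 => if i.val + j.val + 1 = 1 then (1 : L) else 0)).Local v))) ∈ 𝔇.sqPacketsH →
      -- ══ CARPET RELATIONS (named facts of ★ `Ch12Sec5` ∕ ★ `Ch12Sec6`, read at `𝔇`; union of ★ «Sa-COMPOSE» p848625 and ★ (R) p848976) ══
      𝔇.WeylIntegrationFormula → 𝔇.UpSpec → Ch12Sec6.PseudoCoeffExists 𝔇 → Ch12Sec6.PseudoCoeffTrace 𝔇 →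
      Ch12Sec6.Prop1261a 𝔇 → Ch12Sec6.Prop1261b 𝔇 → Ch12Sec6.Prop1261c 𝔇 →
      Ch12Sec6.LdsCharactersOpposite 𝔇 → Ch12Sec6.EllipticOfNotPrincipalSeries 𝔇 → Ch12Sec6.EllipticClassification 𝔇 →
      -- ══ PRINTED INPUTS NO CARPET STATES YET, in the socket shapes of LH6-p01's `Ch12Sec5Inputs` draft: (M1H) `PacketCharRegular`, (UPR) `UpRegular`, (ELL) `EllipticOfL2`,
      --    (DET) `DetNotL2`, (PIN) `PiNNotL2`, (LDS) `LdsNotL2`; and FIVE new sockets for the §12.7 (b)-row: (L2D∀) `D_G·χ_π ∈ L²(T)` for EVERY class, (U2) `D_G·χ_ρ^G ∈ L²(T)`,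
      --    (C1) `cartanG ⊆ cartanAll`, (C2) elliptic representatives a.e. in `G^e`, (C3) the other representatives a.e. in `G^r ∖ G^e` ══
      (∀ ρ ∈ 𝔇.sqPacketsH, Measurable (𝔇.packetCharH ρ) ∧ LocallyIntegrable (𝔇.packetCharH ρ) 𝔇.μH ∧
          Ch12Sec5.IsStableClassFunOn 𝔇.stConjH 𝔇.regH (𝔇.packetCharH ρ) ∧ Ch12Sec5.IsStableClassFunOn 𝔇.stConjH 𝔇.ellH (𝔇.packetCharH ρ) ∧
          ∀ fH : ((UnitaryGroup.cmDatum L 2 (Matrix.of fun i j : Fin 2 => if i.val + j.val + 1 = 2 then (1 : L) else 0)).Local v × (UnitaryGroup.cmDatum L 1 (Matrix.of fun i j : Fin 1 => if i.val + j.val + 1 = 1 then (1 : L) else 0)).Local v) → ℂ, IsLocSmooth fH → (∑ σ ∈ ρ, σ.smoothTrace 𝔇.μH fH) = ∫ h, fH h * 𝔇.packetCharH ρ h ∂𝔇.μH) →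
      (∀ ρ ∈ 𝔇.sqPacketsH, LocallyIntegrable (𝔇.up (𝔇.packetCharH ρ)) 𝔇.μG ∧
          ∀ x ∈ 𝔇.regG, ∀ᶠ y in 𝓝 x, 𝔇.up (𝔇.packetCharH ρ) y = 𝔇.up (𝔇.packetCharH ρ) x) →
      (∀ π : IrrClass (Gqs L v), 𝔇.IsL2 π → 𝔇.IsEllipticRep π) →
      (∀ ψ : ↥(Subgroup.center (Gqs L v)) →* ℂˣ, Continuous ψ → ¬ 𝔇.IsL2 (𝔇.detG ψ)) →
      (∀ ξ' : ((UnitaryGroup.cmDatum L 2 (Matrix.of fun i j : Fin 2 => if i.val + j.val + 1 = 2 then (1 : L) else 0)).Local v × (UnitaryGroup.cmDatum L 1 (Matrix.of fun i j : Fin 1 => if i.val + j.val + 1 = 1 then (1 : L) else 0)).Local v) →* ℂˣ, Continuous ξ' → ¬ 𝔇.IsL2 (𝔇.piN ξ')) →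
      (∀ P ∈ 𝔇.ldsPackets, ∀ σ ∈ P, ¬ 𝔇.IsL2 σ) →
      (∀ π : IrrClass (Gqs L v), ∀ T ∈ 𝔇.cartanG, MemLp (fun t : ↥T => (𝔇.DG (t : Gqs L v) : ℂ) * 𝔇.char π (t : Gqs L v)) 2 (𝔇.μT T)) →
      (∀ ρ ∈ 𝔇.sqPacketsH, ∀ T ∈ 𝔇.cartanG, MemLp (fun t : ↥T => (𝔇.DG (t : Gqs L v) : ℂ) * 𝔇.up (𝔇.packetCharH ρ) (t : Gqs L v)) 2 (𝔇.μT T)) →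
      𝔇.cartanG ⊆ 𝔇.cartanAll →
      (∀ T ∈ 𝔇.cartanG, ∀ᵐ t : ↥T ∂(𝔇.μT T), (t : Gqs L v) ∈ 𝔇.ellG) →
      (∀ T ∈ 𝔇.cartanAll, T ∉ 𝔇.cartanG → ∀ᵐ t : ↥T ∂(𝔇.μT T), (t : Gqs L v) ∈ 𝔇.regG ∧ (t : Gqs L v) ∉ 𝔇.ellG) →
      -- ══ further datum-level sockets of ★ (R) p848976: (LDSE) (LDSU) (LDS2) (R0) (MATE-UNIQ) (ST-L2) (PI2-L2) — (SC-L2) «supercuspidal ⇒ square-integrable» is DISCHARGED below (compact centre at the non-split `v`) ══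
      (∀ P ∈ 𝔇.ldsPackets, ∀ σ ∈ P, 𝔇.IsEllipticRep σ) →
      (∀ P ∈ 𝔇.ldsPackets, ∀ π' ∈ P, ∀ π : IrrClass (Gqs L v), π ∉ P → ¬ 𝔇.IsEllipticPair π π') →
      (∀ P ∈ 𝔇.ldsPackets, ∀ σ ∈ P, ∃ σ' ∈ P, σ' ≠ σ ∧ ∀ τ ∈ P, τ = σ ∨ τ = σ') →
      (∀ P ∈ 𝔇.ldsPackets, ∀ π' ∈ P, ∀ f : Gqs L v → ℂ, 𝔇.IsPseudoCoeff π' f → ∀ fH : ((UnitaryGroup.cmDatum L 2 (Matrix.of fun i j : Fin 2 => if i.val + j.val + 1 = 2 then (1 : L) else 0)).Local v × (UnitaryGroup.cmDatum L 1 (Matrix.of fun i j : Fin 1 => if i.val + j.val + 1 = 1 then (1 : L) else 0)).Local v) → ℂ, IsLocSmooth fH → 𝔇.IsTransfer f fH →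
          (∑ σ ∈ ({πSt} : Finset (IrrClass ((UnitaryGroup.cmDatum L 2 (Matrix.of fun i j : Fin 2 => if i.val + j.val + 1 = 2 then (1 : L) else 0)).Local v × (UnitaryGroup.cmDatum L 1 (Matrix.of fun i j : Fin 1 => if i.val + j.val + 1 = 1 then (1 : L) else 0)).Local v))), σ.smoothTrace 𝔇.μH fH) = 0) →
      (∀ σ u u' : IrrClass (Gqs L v), 𝔇.IsL2 σ → ¬ 𝔇.IsL2 u → ¬ 𝔇.IsL2 u' → 𝔇.IsEllipticPair u σ → 𝔇.IsEllipticPair u' σ → u = u') →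
      (∀ ψ' : ↥(Subgroup.center (Gqs L v)) →* ℂˣ, Continuous ψ' → 𝔇.IsL2 (𝔇.stG ψ')) →
      (∀ ξ' : ((UnitaryGroup.cmDatum L 2 (Matrix.of fun i j : Fin 2 => if i.val + j.val + 1 = 2 then (1 : L) else 0)).Local v × (UnitaryGroup.cmDatum L 1 (Matrix.of fun i j : Fin 1 => if i.val + j.val + 1 = 1 then (1 : L) else 0)).Local v) →* ℂˣ, Continuous ξ' → 𝔇.IsL2 (𝔇.pi2 ξ')) →
      -- ══ THE PRINCIPAL SERIES OF THE NON-SQUARE-INTEGRABLE CLASSES [§12.2]: a parameter map `par` into the tree's PAIR currency, with (PS1) (PS2) (PS3)=(JHL) (NONL2-PAR) (UNIQ-PAR) ══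
      ∀ (par : IrrClass (Gqs L v) → (((UnitaryGroup.LocalRing L v)ˣ →* ℂˣ) × (↥(normOneUnits (conjLocal L (IsCMField.complexConj L) v)) →* ℂˣ))),
      (∀ π ∈ 𝔇.irredPS, ¬ 𝔇.IsL2 π → ∀ f : Gqs L v → ℂ, IsLocSmooth f → π.smoothTrace νQv f = Representation.smoothTrace (G := Gqs L v) (UnitaryGroup.cmPrincipalSeries L 3 v (UnitaryGroup.cmTorusCharPair L v (par π).1 (par π).2)) νQv f) →
      (∀ π σ : IrrClass (Gqs L v), ¬ 𝔇.IsL2 π → 𝔇.IsL2 σ → 𝔇.IsEllipticPair π σ → ∀ f : Gqs L v → ℂ, IsLocSmooth f →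
          π.smoothTrace νQv f + σ.smoothTrace νQv f = Representation.smoothTrace (G := Gqs L v) (UnitaryGroup.cmPrincipalSeries L 3 v (UnitaryGroup.cmTorusCharPair L v (par π).1 (par π).2)) νQv f) →
      (∀ P ∈ 𝔇.ldsPackets, ∀ π' ∈ P, ∀ π'' ∈ P, π' ≠ π'' → par π'' = par π' ∧ ∀ f : Gqs L v → ℂ, IsLocSmooth f →
          π'.smoothTrace νQv f + π''.smoothTrace νQv f = Representation.smoothTrace (G := Gqs L v) (UnitaryGroup.cmPrincipalSeries L 3 v (UnitaryGroup.cmTorusCharPair L v (par π').1 (par π').2)) νQv f) →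
      (∀ π : IrrClass (Gqs L v), ¬ 𝔇.IsL2 π →
          π.IsConstituentOf (UnitaryGroup.cmPrincipalSeries L 3 v (UnitaryGroup.cmTorusCharPair L v (par π).1 (par π).2)) ∧
            Continuous (par π).1 ∧ Continuous (par π).2) →
      (∀ u u' : IrrClass (Gqs L v), ¬ 𝔇.IsL2 u → ¬ 𝔇.IsL2 u' →
          (par u' = par u ∨ par u' = (conjInvChar (conjLocal L (IsCMField.complexConj L) v) (par u).1, (par u).2)) →
          u' = u ∨ ∃ P ∈ 𝔇.ldsPackets, u ∈ P ∧ u' ∈ P) →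
      -- ══ LH6-p05's split-torus block in place of §1's binder `hF` (★ F3′ p849140's sockets, ∀-forms) ══
      -- ══ (SPLIT-NOT-ELL) «a REGULAR element of the split torus `T ⊂ U(Φ₃)(L⁺_v)` is not in `G^e`» [§12.5 p. 184] — the structural socket that ★ «PSE★» `F0P3cStCharTSPsePseudo` trades (PSE) for ══
      (∀ t : ↥(cmBorelTriple L 3 v).M, IsRegularElt ((((t : ↥(unitaryGroupOfForm (conjLocal L (IsCMField.complexConj L) v) (cmLocalForm L 3 v))) : Gqs L v).val : GL (Fin 3) (UnitaryGroup.LocalRing L v))) → ((t : ↥(unitaryGroupOfForm (conjLocal L (IsCMField.complexConj L) v) (cmLocalForm L 3 v))) : Gqs L v) ∉ 𝔇.ellG) →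
      -- ══ (M1) THE PACKAGE'S OWN HARISH-CHANDRA SOCKET `𝔇.CharRegularity` (★ `Ch12Sec5Inputs` :119: for square-integrable `π`, `χ_π` is measurable, locally integrable,
      --    locally constant on `G^{reg}` and represents the trace) [§1.6 pp. 5–6] — a BINDER here (the leaf already carries it among the 19 sockets) ══
      𝔇.CharRegularity →
      -- ══ (CHAR-CL) «the character of a square-integrable `π` is a CLASS FUNCTION on `G^{reg}`» [§1.6 p. 5] — the one clause of ED. 7's (CHAR-G) that (M1) does not state
      --    (it would follow from (M1) for ADMISSIBLE representatives, ★ `smoothTrace_comap` + ★ `IrrClass.comap_eq_self_of_forall_eq_conj`; admissibility is not in the organ's frame) ══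
      (∀ π : IrrClass (Gqs L v), 𝔇.IsL2 π → Ch12Sec5.IsClassFunOn 𝔇.regG (𝔇.char π)) →
      -- ══ (TOR⁗) THE SPLIT-TORUS PACKAGE WITH THE WEYL SOCKET DISCHARGED: for EVERY Haar measure `μM` on `M = E_vˣ × E¹_v` (Borel σ-algebra at statement level),
      --    Casselman's two integrability sentences at PRINT'S DENSITY `D_G = |D_G(γ)|^{1∕2}` = van Dijk's weight `Δ ∘ ι` (★ `vanDijkWeight`; `= max(‖α‖, ‖α‖⁻¹)` off `M_c`,
      --    `= |a−1|·|b−1|^{1∕2}` on `M_c`, vanishing at the singular torus points — «`F_f(γ) = D_G(γ)Φ(γ, f)`» p. 191, «`D_G(γ) = ‖α‖⁻¹` for `‖α‖ < 1`» p. 193):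
      --    (L1M) «for all square-integrable `π`, the restriction of `D_G(γ)χ_π(γ)` to `M` is an integrable function» [L. 12.7.2 proof p. 193] and (L1M-up) the same for
      --    `D_G·χ_ρ^G`, `ρ = St_H(ξ_v)` [L. 12.5.1 p. 183; p. 193].  The Weyl integration formula (WIF°) is now the THEOREM ★ `…WeylCoreDensity.weylIntegration_core_of_shells`
      --    over ★ `…ShellsTT` (Hecke shells); the shell surjectivity (SHF′°) is the THEOREM ★ `shf_core` — so NO Weyl-side socket remains ══
      (letI : MeasurableSpace ((UnitaryGroup.LocalRing L v)ˣ × ↥(normOneUnits (conjLocal L (IsCMField.complexConj L) v))) := borel _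
      haveI : BorelSpace ((UnitaryGroup.LocalRing L v)ˣ × ↥(normOneUnits (conjLocal L (IsCMField.complexConj L) v))) := ⟨rfl⟩
      ∀ (μM : Measure ((UnitaryGroup.LocalRing L v)ˣ × ↥(normOneUnits (conjLocal L (IsCMField.complexConj L) v)))) [μM.IsHaarMeasure],
        -- (L1M) `D_G χ_σ|_M ∈ L¹(M)` for every square-integrable `σ` [p. 193]
        (∀ σ : IrrClass (Gqs L v), σ.IsSquareIntegrable μZ → Integrable (fun m => (((vanDijkWeight L v (torusChart L v m)).re : ℝ) : ℂ) * 𝔇.char σ (((torusChart L v m : ↥(cmBorelTriple L 3 v).M) : ↥(unitaryGroupOfForm (conjLocal L (IsCMField.complexConj L) v) (cmLocalForm L 3 v))) : Gqs L v)) μM) ∧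
        -- (L1M-up) `D_G χ_ρ^G|_M ∈ L¹(M)` for `ρ = St_H(ξ_v)` [L. 12.5.1 p. 183; p. 193]
        Integrable (fun m => (((vanDijkWeight L v (torusChart L v m)).re : ℝ) : ℂ) * 𝔇.up (𝔇.packetCharH {πSt}) (((torusChart L v m : ↥(cmBorelTriple L 3 v).M) : ↥(unitaryGroupOfForm (conjLocal L (IsCMField.complexConj L) v) (cmLocalForm L 3 v))) : Gqs L v)) μM) →
      ∀ aX : IrrClass (Gqs L v) → ℤ, (Function.support aX).Countable →
        (∀ π : IrrClass (Gqs L v), aX π ≠ 0 → π.IsUnitarizable) →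
        (∀ (fH : ((UnitaryGroup.cmDatum L 2 (Matrix.of fun i j : Fin 2 => if i.val + j.val + 1 = 2 then (1 : L) else 0)).Local v × (UnitaryGroup.cmDatum L 1 (Matrix.of fun i j : Fin 1 => if i.val + j.val + 1 = 1 then (1 : L) else 0)).Local v) → ℂ) (φ : Gqs L v → ℂ), IsLocSmooth fH → IsLocSmooth φ →
            IsLocalDeltaTransfer L (qsForm L) v ((finExplicitCollection L (qsForm L) μ (finExplicitDelta_conj_left_all L (qsForm L) μ) (finExplicitDelta_conj_right_all L (qsForm L) μ)) v) mHv mQv fH φ →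
            Summable (fun π : IrrClass (Gqs L v) => (aX π : ℂ) * π.smoothTrace νQv φ) ∧
              ∑' π : IrrClass (Gqs L v), (aX π : ℂ) * π.smoothTrace νQv φ = πSt.smoothTrace νHv fH) →
        (Function.support aX).Finite ∧ ∀ π : IrrClass (Gqs L v), aX π ≠ 0 → π.IsSquareIntegrable μZ := by
  intro L _ _ _ μ ξ v hns hμu hμω _ _ _ _ νHv νQv _ _ _ _ mHv mQv hcanH hcanQ hTv π₁ πSt hHL hπ₁ _ _ μZ _
    𝔇 hμG hμH hμGZ horb hreg hTr hρ hW hUp hPCE hPCT h61a h61b h61c hLO hEONPS hEC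
    hHCH hUpReg hEll hDet hPiN hLds hL2domAll hUdom hsub hTell hTnon
    hLdsE hLdsU hLds2 hR0 hMU hStL2 hPi2L2
    par hPS1 hPS2 hPS3 hNP hUP
    hsplit hHC hCL hTOR
    aX hcnt hunit hid
  -- the organ's quotient σ-algebras and the Borel structure of `M`, re-installed as local instances
  letI : ∀ γ : Gqs L v, MeasurableSpace (Gqs L v ⧸ Subgroup.centralizer ({γ} : Set (Gqs L v))) := fun _ => borel _
  haveI : ∀ γ : Gqs L v, BorelSpace (Gqs L v ⧸ Subgroup.centralizer ({γ} : Set (Gqs L v))) := fun _ => ⟨rfl⟩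
  letI : MeasurableSpace ((UnitaryGroup.LocalRing L v)ˣ × ↥(normOneUnits (conjLocal L (IsCMField.complexConj L) v))) := borel _
  haveI : BorelSpace ((UnitaryGroup.LocalRing L v)ˣ × ↥(normOneUnits (conjLocal L (IsCMField.complexConj L) v))) := ⟨rfl⟩
  -- «VDW-SYMM★» (LH6-p02 (g2), ★ p849696): the W-invariance of van Dijk's weight, read through ★ `vanDijkWeight` (as in ★ p849719)
  have hVDW : ∀ (w₀ : ↥(unitaryGroupOfForm (conjLocal L (IsCMField.complexConj L) v) (cmLocalForm L 3 v))) (hw₀ : Units.val (w₀ : GL (Fin 3) (UnitaryGroup.LocalRing L v)) = cmLocalForm L 3 v) (t : ↥(cmBorelTriple L 3 v).M),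
      vanDijkWeight L v ⟨w₀ * (t : ↥(unitaryGroupOfForm (conjLocal L (IsCMField.complexConj L) v) (cmLocalForm L 3 v))) * w₀⁻¹, weylConj_mem_cmTorus L v w₀ hw₀ t⟩ = vanDijkWeight L v t :=
    fun w₀ hw₀ t => F0P3cStCharTSVanDijkWeylSymm.vanDijkWeight_weylConj L v w₀ hw₀ t ⟨w₀ * (t : ↥(unitaryGroupOfForm (conjLocal L (IsCMField.complexConj L) v) (cmLocalForm L 3 v))) * w₀⁻¹, weylConj_mem_cmTorus L v w₀ hw₀ t⟩ rfl
  -- the place `w` of the package and the core `Ω°` at `w`: regular (★ (H3′)), inside the hyperbolic set (★ (H3)), hence class functions on `G^{reg}` are conj-invariant on it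
  obtain ⟨w⟩ : Nonempty (PlacesOver L v) := inferInstance
  have hΩreg : {γ : Gqs L v | 1 < Valued.v ((Pi.evalRingHom (fun w' : PlacesOver L v => w'.1.adicCompletion L) w) ((γ.val : GL (Fin 3) (UnitaryGroup.LocalRing L v)) : Matrix (Fin 3) (Fin 3) (UnitaryGroup.LocalRing L v)).trace)} ⊆ {γ : Gqs L v | IsRegularElt (γ.val : GL (Fin 3) (UnitaryGroup.LocalRing L v))} :=
    setOf_one_lt_v_trace_subset_setOf_isRegularElt L v hns w
  have hΩhyp : {γ : Gqs L v | 1 < Valued.v ((Pi.evalRingHom (fun w' : PlacesOver L v => w'.1.adicCompletion L) w) ((γ.val : GL (Fin 3) (UnitaryGroup.LocalRing L v)) : Matrix (Fin 3) (Fin 3) (UnitaryGroup.LocalRing L v)).trace)} ⊆ hyperbolicSet L v :=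
    setOf_one_lt_v_trace_subset_hyperbolicSet L v hns w
  have hclΩ : ∀ α : Gqs L v → ℂ, Ch12Sec5.IsClassFunOn 𝔇.regG α → ∀ g ∈ {γ : Gqs L v | 1 < Valued.v ((Pi.evalRingHom (fun w' : PlacesOver L v => w'.1.adicCompletion L) w) ((γ.val : GL (Fin 3) (UnitaryGroup.LocalRing L v)) : Matrix (Fin 3) (Fin 3) (UnitaryGroup.LocalRing L v)).trace)}, ∀ h : Gqs L v, α (h * g * h⁻¹) = α g :=
    fun α hα g hg h => hα g ((hreg g).mpr (hΩreg hg)) h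
  refine F0P3cStCharTSSaHeadTorus.stSupportFiniteSqInt_of_carpet_torus L μ ξ v hns hμu hμω νHv νQv mHv mQv hcanH hcanQ hTv π₁ πSt hHL hπ₁ μZ
    𝔇 hμG hμH hμGZ horb hreg hTr hρ hW hUp hPCE hPCT h61a h61b h61c hLO hEONPS hEC hHCH hUpReg hEll hDet hPiN hLds hL2domAll hUdom hsub hTell hTnon
    hLdsE hLdsU hLds2 hR0 hMU hStL2 hPi2L2 par hPS1 hPS2 hPS3 hNP hUP hsplit ?_ aX hcnt hunit hid
  -- ══ (TOR) of ★ p849458 from (M1)+(CHAR-CL)+(TOR⁗): `Ω := Ω°`, pin `rfl`; (WIF°) at `Δ∘ι` = ★ `weylIntegration_core_of_shells` over ★ shells (+ the `M_c` congruence of ★ ₆); (SHF′°) = ★ `shf_core` ══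
  intro μM _
  obtain ⟨hL1, hL1up⟩ := hTOR μM
  obtain ⟨Mlev, hMo, hMa, hMb, hM0, hMr, hSH⟩ := F0P3cStCharTSShellsTTLevels.exists_levels_shellsTT L v hns w νQv hcanQ μM
  have hWIF0 := F0P3cStCharTSWeylCoreDensity.weylIntegration_core_of_shells L v hns w νQv hcanQ μM Mlev hMo hMa hMb hM0 hMr hSH
  have hSHF := F0P3cStCharTSShellsTTLevels.shf_core L v hns w νQv hcanQ μM
  -- (WIF°) at the print-exact density `Δ ∘ ι` (★ ₆'s congruence: `= max(‖α‖,‖α‖⁻¹)` off `M_c` ★ `vanDijkWeight_torusChart_of_not_mem`; on `M_c` the torus transform of an `Ω°`-supported `φ` is `0`)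
  have hWIF :
      (∀ α : Gqs L v → ℂ, Measurable α → LocallyIntegrable α νQv → (∀ g ∈ {γ : Gqs L v | 1 < Valued.v ((Pi.evalRingHom (fun w' : PlacesOver L v => w'.1.adicCompletion L) w) ((γ.val : GL (Fin 3) (UnitaryGroup.LocalRing L v)) : Matrix (Fin 3) (Fin 3) (UnitaryGroup.LocalRing L v)).trace)}, ∀ h : Gqs L v, α (h * g * h⁻¹) = α g) →
      ∀ φ : Gqs L v → ℂ, IsLocSmooth φ → tsupport φ ⊆ {γ : Gqs L v | 1 < Valued.v ((Pi.evalRingHom (fun w' : PlacesOver L v => w'.1.adicCompletion L) w) ((γ.val : GL (Fin 3) (UnitaryGroup.LocalRing L v)) : Matrix (Fin 3) (Fin 3) (UnitaryGroup.LocalRing L v)).trace)} →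
      ∫ g, φ g * α g ∂νQv = ∫ m, torusTransform L v mQv μM φ m * ((((vanDijkWeight L v (torusChart L v m)).re : ℝ) : ℂ) * α (((torusChart L v m : ↥(cmBorelTriple L 3 v).M) : ↥(unitaryGroupOfForm (conjLocal L (IsCMField.complexConj L) v) (cmLocalForm L 3 v))) : Gqs L v)) ∂μM) := by
    intro α hαm hαli hαinv φ hφ hsupp
    rw [hWIF0 α hαm hαli hαinv φ hφ hsupp]
    refine integral_congr_ae (Filter.Eventually.of_forall fun m => ?_)
    dsimp only
    by_cases hm : m ∈ ((Submonoid.pi Set.univ (fun w : PlacesOver L v => (w.1.adicCompletionIntegers L).toSubring.toSubmonoid)).units.prod (⊤ : Subgroup ↥(normOneUnits (conjLocal L (IsCMField.complexConj L) v))))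
    · haveI : Subsingleton (PlacesOver L v) := PlacesOver.subsingleton_of_smul_eq (IsCMField.complexConj L) (IsCMField.complexConj_ne_one L) w (hns w)
      have hv1 : Valued.v ((m.1 : UnitaryGroup.LocalRing L v) w) = 1 := (mem_unitsIntegers_iff L v m.1).1 (Subgroup.mem_prod.1 hm).1 w
      have hnot : ¬ (1 < Valued.v ((Pi.evalRingHom (fun w' : PlacesOver L v => w'.1.adicCompletion L) w) (((((torusChart L v m : ↥(cmBorelTriple L 3 v).M) : ↥(unitaryGroupOfForm (conjLocal L (IsCMField.complexConj L) v) (cmLocalForm L 3 v))) : GL (Fin 3) (UnitaryGroup.LocalRing L v)) : Matrix (Fin 3) (Fin 3) (UnitaryGroup.LocalRing L v)).trace))) :=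
        fun h => ((one_lt_v_trace_torusChart_iff L v hns w m).1 h) hv1
      have hO : classOrbitalIntegral mQv φ (ConjClasses.mk (((torusChart L v m : ↥(cmBorelTriple L 3 v).M) : ↥(unitaryGroupOfForm (conjLocal L (IsCMField.complexConj L) v) (cmLocalForm L 3 v))) : Gqs L v)) = 0 := by
        refine classOrbitalIntegral_mk_eq_zero_of_forall_conj_notMem_tsupport mQv fun y hy => hnot ?_
        exact (conj_mem_setOf_one_lt_v_trace_iff L v w _ y).1 (hsupp hy)
      have hT : torusTransform L v mQv μM φ m = 0 := by
        show (_ : ℂ) * (vanDijkWeight L v (torusChart L v m) * classOrbitalIntegral mQv φ (ConjClasses.mk (((torusChart L v m : ↥(cmBorelTriple L 3 v).M) : ↥(unitaryGroupOfForm (conjLocal L (IsCMField.complexConj L) v) (cmLocalForm L 3 v))) : Gqs L v))) = 0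
        rw [hO, mul_zero, mul_zero]
      rw [hT, zero_mul, zero_mul]
    · rw [F0P3cStCharTSShellWeight.vanDijkWeight_torusChart_of_not_mem L v hns m hm, Complex.ofReal_re]
  refine ⟨torusTransform L v mQv μM, {γ : Gqs L v | 1 < Valued.v ((Pi.evalRingHom (fun w' : PlacesOver L v => w'.1.adicCompletion L) w) ((γ.val : GL (Fin 3) (UnitaryGroup.LocalRing L v)) : Matrix (Fin 3) (Fin 3) (UnitaryGroup.LocalRing L v)).trace)}, pairChar L v, fun χ m => pairChar_apply L v χ m, ?_, ?_, ?_, hSHF⟩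
  · -- (WM∕L2M): `Θ_σ := Δ∘ι · χ_σ ∘ ι` — regularity from (M1) at `𝔇.IsL2 σ` (COMPAT `hμGZ`), class function from (CHAR-CL)
    intro σ hσ
    refine ⟨fun m => (((vanDijkWeight L v (torusChart L v m)).re : ℝ) : ℂ) * 𝔇.char σ (((torusChart L v m : ↥(cmBorelTriple L 3 v).M) : ↥(unitaryGroupOfForm (conjLocal L (IsCMField.complexConj L) v) (cmLocalForm L 3 v))) : Gqs L v),
      hL1 σ hσ, ?_⟩
    rintro φ ⟨hφ, hsupp⟩
    have hL2 : 𝔇.IsL2 σ := by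
      show IrrClass.IsSquareIntegrable 𝔇.μGZ σ
      rw [hμGZ]; exact hσ
    obtain ⟨hmeas, hli, -, htr⟩ := hHC σ hL2
    have hcl := hCL σ hL2
    rw [hμG] at hli htr
    rw [htr φ hφ]
    exact hWIF (𝔇.char σ) hmeas hli (hclΩ _ hcl) φ hφ hsupp
  · -- (HM): `Θ_ρ := Δ∘ι · χ_ρ^G ∘ ι`, `χ_ρ^G = 𝔇.up (packetCharH {πSt})`
    refine ⟨fun m => (((vanDijkWeight L v (torusChart L v m)).re : ℝ) : ℂ) * 𝔇.up (𝔇.packetCharH {πSt}) (((torusChart L v m : ↥(cmBorelTriple L 3 v).M) : ↥(unitaryGroupOfForm (conjLocal L (IsCMField.complexConj L) v) (cmLocalForm L 3 v))) : Gqs L v),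
      hL1up, ?_⟩
    rintro φ fH ⟨hφ, hsupp⟩ ⟨hfH, htrans⟩
    obtain ⟨hmeasH, hliH, hstH, -, htrH⟩ := hHCH {πSt} hρ
    obtain ⟨hmeasU, hclU, hupId⟩ := hUp (𝔇.packetCharH {πSt}) hmeasH hstH
    have hliU : LocallyIntegrable (𝔇.up (𝔇.packetCharH {πSt})) 𝔇.μG := (hUpReg {πSt} hρ).1
    -- (M1H) at the singleton packet `{πSt}`: `Tr πSt(fH) = ∫_H fH · χ_ρ`
    have h1 : πSt.smoothTrace νHv fH = ∫ h, fH h * 𝔇.packetCharH {πSt} h ∂𝔇.μH := by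
      have h := htrH fH hfH
      rw [Finset.sum_singleton, hμH] at h
      rw [hμH]; exact h
    -- `UpSpec` at the transfer pair `(φ, fH)`: `∫_G φ · χ_ρ^G = ∫_H fH · χ_ρ` (convergence: local integrability × compact supports)
    have hφSB : φ ∈ SchwartzBruhat (Gqs L v) := hφ
    have hintG : Integrable (fun g => φ g * 𝔇.up (𝔇.packetCharH {πSt}) g) 𝔇.μG := by
      simpa only [smul_eq_mul] using hliU.integrable_smul_left_of_hasCompactSupport hφ.1.continuous hφ.2
    have hintH : Integrable (fun h => fH h * 𝔇.packetCharH {πSt} h) 𝔇.μH := by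
      simpa only [smul_eq_mul] using hliH.integrable_smul_left_of_hasCompactSupport hfH.1.continuous hfH.2
    have h2 := hupId φ hφSB fH ((hTr φ fH).mpr htrans) hintG hintH
    rw [h1, ← h2, hμG]
    rw [hμG] at hliU
    exact hWIF _ hmeasU hliU (hclΩ _ hclU) φ hφ hsupp
  · -- (PSM) on `Ω°`: ★ p849653 (no support condition is used by its proof; we feed `Ω° ⊆ hyperbolicSet`)
    intro χ hχ1 hχ2 φ hφ
    exact psm_torusTransform L v hns νQv mQv hcanQ μM hVDW χ hχ1 hχ2 φ ⟨hφ.1, hφ.2.trans hΩhyp⟩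

end Summit.HodgeConjecture.HodgeConjecture.Cruxes.H413.F0P3cStCharTSSaHeadTorus7

end
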